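import Mathlib
import Literature.Probability.Percolation.DiagonalStripRelativePairBound
import Literature.Probability.Percolation.DiagonalStripWFree
import HarnessLib

/-!
# IP12 Prop. 4.7 from the minimal polynomial qKZ solution

Topic `Literature/Probability/Percolation`. Assembly of the proof of Ikhlef–Ponsaing's
first-passage formula (J. Stat. Phys. 149 (2012), arXiv:1202.5476, Prop. 4.7,
`IkhlefPonsaingFirstPassage`). `ikhlefPonsaingFirstPassage_of_bounds`
(`DiagonalStripHomogeneousPoint`) reduces it to `GroundStateBounds` for the primitive ground state
at every width; its three clauses are now derived: `wfree` (`DiagonalStripWFree`), `vanish`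
(`DiagonalStripTransferAtZero`) and `pair` from the relative pair bound
(`DiagonalStripRelativePairBound`) plus the pinning of the twist `-a ≤ 2m`
(**`IsGroundState.neg_twist_le`**), which follows by qKZ uniqueness and primitivity from the
EXISTENCE of a polynomial solution of the qKZ system with twist `-4m` (**`IsMinimalQKZSolution`**,
IP12 §3.5 / de Gier–Pyatov arXiv:0710.5362 Thm. 1, Props. 3–4 — the one input IP12 import rather
than prove). Main result: **`ikhlefPonsaingFirstPassage_of_polynomialSolution`**.

## References

* Y. Ikhlef, A. K. Ponsaing, *Finite-size left-passage probability in percolation*, J. Stat. Phys.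
  149 (2012) 10–36, arXiv:1202.5476, §3.4–3.6, Prop. 4.7. [IkhlefPonsaing2012]
* J. de Gier, P. Pyatov, *Factorised solutions of Temperley–Lieb qKZ equations on a segment*,
  Adv. Theor. Math. Phys. 14 (2010) 795–877, arXiv:0710.5362. [deGierPyatov2010]
-/

namespace Literature.Probability.Percolation

open Finset Literature.Probability.LatticeModels

/-! ## Final assembly -/

section Assembly

open MvPolynomial

variable {m : ℕ} {q : ℂ}

/-- The exchange relations are linear over `σ_i`-invariant scalars. [folklore] -/
theorem IsExactExchange.mul_left {i : ℕ} {g : ColPattern m → ColPattern m} {ψ : ColPattern m → RapidityField ℂ}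
    (hex : IsExactExchange q i g ψ) {f : RapidityField ℂ} (hf : genSwap ℂ i f = f) :
    IsExactExchange q i g (fun Q => f * ψ Q) := by
  intro Q
  have h := hex Q
  have hpush : ipPush g (fun Q => f * ψ Q) Q = f * ipPush g ψ Q := by unfold ipPush; rw [Finset.mul_sum]
  rw [hpush, map_mul, hf]
  linear_combination f * h

/-- The symmetric monomial `Π := ∏_{k=1}^{2m+1} z_k`. [folklore] -/
noncomputable def genZProd (m : ℕ) : RapidityField ℂ := ∏ k ∈ Finset.Icc 1 (2 * m + 1), genZ ℂ k

/-- `Π ≠ 0`. [folklore] -/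
theorem genZProd_ne_zero (m : ℕ) : genZProd m ≠ 0 :=
  Finset.prod_ne_zero_iff.2 fun k _ => genZ_ne_zero k

/-- `σ_i Π = Π` for `1 ≤ i ≤ 2m`. [folklore] -/
theorem genSwap_genZProd {i : ℕ} (hi1 : 1 ≤ i) (hi2 : i ≤ 2 * m) : genSwap ℂ i (genZProd m) = genZProd m := by
  unfold genZProd
  rw [map_prod]
  simp_rw [genSwap_genZ, zswap]
  exact Finset.prod_equiv (Equiv.swap i (i + 1)) (fun k => by
    simp only [Finset.mem_Icc]
    rw [Equiv.swap_apply_def]; split_ifs <;> omega) (fun k _ => by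
    rw [Equiv.swap_apply_def]; split_ifs <;> rfl)

/-- `ι_k Π = z_k^{-2} Π` for `1 ≤ k ≤ 2m+1`. [folklore] -/
theorem genInv_genZProd {k : ℕ} (hk1 : 1 ≤ k) (hk2 : k ≤ 2 * m + 1) :
    genInv ℂ k (genZProd m) = (genZ ℂ k)⁻¹ ^ 2 * genZProd m := by
  unfold genZProd
  rw [map_prod, ← Finset.mul_prod_erase _ _ (Finset.mem_Icc.2 ⟨hk1, hk2⟩),
    ← Finset.mul_prod_erase (Finset.Icc 1 (2 * m + 1)) (fun k => genZ ℂ k) (Finset.mem_Icc.2 ⟨hk1, hk2⟩)]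
  rw [genInv_genZ, Function.update_self,
    Finset.prod_congr rfl fun n hn => by rw [genInv_genZ, Function.update_of_ne (Finset.ne_of_mem_erase hn)]]
  field_simp

/-- `ι_k (Π^{-c}) = z_k^{2c} Π^{-c}`. [folklore] -/
theorem genInv_genZProd_zpow {k : ℕ} (hk1 : 1 ≤ k) (hk2 : k ≤ 2 * m + 1) (c : ℤ) :
    genInv ℂ k (genZProd m ^ (-c)) = genZ ℂ k ^ (2 * c) * genZProd m ^ (-c) := by
  have h2 : ((genZ ℂ k)⁻¹ ^ 2) ^ (-c) = genZ ℂ k ^ (2 * c) := by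
    rw [inv_pow, inv_zpow', neg_neg, ← zpow_natCast, ← zpow_mul]; norm_num
  rw [map_zpow₀, genInv_genZProd hk1 hk2, mul_zpow, h2]

/-- **A polynomial solution of IP12's qKZ system (20)–(22) with the minimal twist `-4m`**:
a nonzero family of polynomials indexed by the link patterns (valid planar lumped even-column
patterns, zero elsewhere) satisfying the exchange relations at all bulk levels and both reflection
relations with twist `-4m` — the polynomial normalisation `∏ z_i^{2m} |Ψ_{2m+1}⟩` of the
minimal-degree solution of IP12 §3.5 (base component displayed there, the other components by the
factorised operators of de Gier–Pyatov, arXiv:0710.5362, Thm. 1, Props. 3–4). Its EXISTENCE is the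
one input of IP12's proof imported from [dGP]/[DF05] ("the degree of `Z_L` is set by solving the
qKZ equation", §3.6); it is the hypothesis of `ikhlefPonsaingFirstPassage_of_polynomialSolution`.
[cite: IkhlefPonsaing2012, §3.4–3.5] -/
structure IsMinimalQKZSolution (m : ℕ) (q : ℂ) (Φ : ColPattern m → MvPolynomial ℕ ℂ) : Prop where
  ne_zero : Φ ≠ 0
  supp : ∀ Q, Φ Q ≠ 0 → IsValid 0 Q ∧ IsPlanar Q ∧ lump Q = Q
  odd : ∀ j' : Fin m, IsExactExchange q (2 * (j' : ℕ) + 1) (cpJoin (Fin.castSucc j') j'.succ) (fun Q => toRF ℂ (Φ Q))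
  even : ∀ b0 : Fin m, IsExactExchange q (2 * (b0 : ℕ) + 2) (cpIsolate b0.succ) (fun Q => toRF ℂ (Φ Q))
  top : ∀ Q, genInv ℂ (2 * m + 1) (toRF ℂ (Φ Q)) = genZ ℂ (2 * m + 1) ^ (2 * (-(2 * (m : ℤ)))) * toRF ℂ (Φ Q)
  bot : ∀ Q, genInv ℂ 1 (toRF ℂ (Φ Q)) = genZ ℂ 1 ^ (2 * (-(2 * (m : ℤ)))) * toRF ℂ (Φ Q)

namespace IsGroundState

variable {P : ColPattern m → MvPolynomial ℕ ℂ} {a : ℤ}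

/-- **The polynomial qKZ solution pins the twist**: `-a ≤ 2m`. (By uniqueness the solution `Φ` of
twist `-4m` is `C₀ · P` for a polynomial `C₀`, so `deg_{z_1} P_Q ≤ 4m`; a component with nonzero
value at `z_1 = 0` — one exists by primitivity — has `z_1`-degree `-2a`.)
[cite: IkhlefPonsaing2012, §3.5–3.6] -/
theorem neg_twist_le (hq : q ^ 2 + q + 1 = 0) (h : IsGroundState m q P a) {Φ : ColPattern m → MvPolynomial ℕ ℂ}
    (hΦ0 : Φ ≠ 0) (hsuppΦ : ∀ Q, Φ Q ≠ 0 → IsValid 0 Q ∧ IsPlanar Q ∧ lump Q = Q)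
    (hoddΦ : ∀ j' : Fin m, IsExactExchange q (2 * (j' : ℕ) + 1) (cpJoin (Fin.castSucc j') j'.succ) (fun Q => toRF ℂ (Φ Q)))
    (hevenΦ : ∀ b0 : Fin m, IsExactExchange q (2 * (b0 : ℕ) + 2) (cpIsolate b0.succ) (fun Q => toRF ℂ (Φ Q)))
    (htopΦ : ∀ Q, genInv ℂ (2 * m + 1) (toRF ℂ (Φ Q)) = genZ ℂ (2 * m + 1) ^ (2 * (-(2 * (m : ℤ)))) * toRF ℂ (Φ Q))
    (hbotΦ : ∀ Q, genInv ℂ 1 (toRF ℂ (Φ Q)) = genZ ℂ 1 ^ (2 * (-(2 * (m : ℤ)))) * toRF ℂ (Φ Q)) :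
    -a ≤ 2 * m := by
  classical
  set c : ℤ := a + 2 * m with hc
  set f : RapidityField ℂ := genZProd m ^ (-c) with hf
  have hf0 : f ≠ 0 := zpow_ne_zero _ (genZProd_ne_zero m)
  -- transport `Φ` to twist `a`
  set ψ' : ColPattern m → RapidityField ℂ := fun Q => f * toRF ℂ (Φ Q) with hψ'
  have hsupp' : ∀ Q, ψ' Q ≠ 0 → IsValid 0 Q ∧ IsPlanar Q ∧ lump Q = Q := fun Q hQ =>
    hsuppΦ Q fun h0 => hQ (by simp only [hψ', h0, map_zero, mul_zero])
  have hodd' : ∀ j' : Fin m, IsExactExchange q (2 * (j' : ℕ) + 1) (cpJoin (Fin.castSucc j') j'.succ) ψ' := fun j' =>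
    (hoddΦ j').mul_left (by have := j'.isLt; rw [hf, map_zpow₀, genSwap_genZProd (by omega) (by omega)])
  have heven' : ∀ b0 : Fin m, IsExactExchange q (2 * (b0 : ℕ) + 2) (cpIsolate b0.succ) ψ' := fun b0 =>
    (hevenΦ b0).mul_left (by have := b0.isLt; rw [hf, map_zpow₀, genSwap_genZProd (by omega) (by omega)])
  have htwist : ∀ (k : ℕ), 1 ≤ k → k ≤ 2 * m + 1 → ∀ Q,
      genInv ℂ k (toRF ℂ (Φ Q)) = genZ ℂ k ^ (2 * (-(2 * (m : ℤ)))) * toRF ℂ (Φ Q) →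
      genInv ℂ k (ψ' Q) = genZ ℂ k ^ (2 * a) * ψ' Q := by
    intro k hk1 hk2 Q hΦ
    simp only [hψ']
    rw [map_mul, hf, genInv_genZProd_zpow hk1 hk2, hΦ]
    rw [show (2 * a : ℤ) = 2 * c + 2 * (-(2 * (m : ℤ))) from by rw [hc]; ring, zpow_add₀ (genZ_ne_zero k)]
    ring
  have hbot' : ∀ Q, genInv ℂ 1 (ψ' Q) = genZ ℂ 1 ^ (2 * a) * ψ' Q := fun Q => htwist 1 le_rfl (by omega) Q (hbotΦ Q)
  have htop' : ∀ Q, genInv ℂ (2 * m + 1) (ψ' Q) = genZ ℂ (2 * m + 1) ^ (2 * a) * ψ' Q := fun Q =>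
    htwist (2 * m + 1) (by omega) le_rfl Q (htopΦ Q)
  obtain ⟨c₀, hc₀⟩ := qKZ_solution_eq_smul_groundState hq h.prim h.fixed h.odd h.even h.top h.bot hsupp' hodd' heven' hbot' htop'
  -- `Φ = C₀ · P`
  have hprop : ∀ Q, toRF ℂ (Φ Q) = c₀ / f * toRF ℂ (P Q) := fun Q => by
    have := hc₀ Q; simp only [hψ'] at this
    rw [div_mul_eq_mul_div, eq_div_iff hf0, mul_comm]; exact this
  obtain ⟨C₀, hC₀⟩ := h.prim.exists_eq_toRF (c := c₀ / f) fun Q => ⟨Φ Q, (hprop Q).symm⟩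
  have hΦP : ∀ Q, Φ Q = C₀ * P Q := fun Q => toRF_injective (by rw [hprop Q, hC₀, map_mul])
  have hC₀0 : C₀ ≠ 0 := by
    rintro rfl; exact hΦ0 (funext fun Q => by rw [hΦP Q, zero_mul]; rfl)
  -- degrees of `Φ`
  have hdegΦ : ∀ Q, (Φ Q).degreeOf 1 ≤ 4 * m := fun Q => by
    refine degreeOf_le_of_genInv_mul_pow (K₀ := ℂ) ?_
    rw [hbotΦ Q, mul_assoc, mul_comm (toRF ℂ (Φ Q)), ← mul_assoc, ← zpow_natCast, ← zpow_add₀ (genZ_ne_zero 1)]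
    have : (2 * -(2 * (m : ℤ)) + ((4 * m : ℕ) : ℤ)) = 0 := by push_cast; ring
    rw [this, zpow_zero, one_mul]
  -- a component not divisible by `X_1`
  obtain ⟨Q₁, hQ₁⟩ : ∃ Q₁, substHom 1 0 (P Q₁) ≠ 0 := by
    by_contra hall
    push Not at hall
    have hdvd : ∀ Q, (X 1 : MvPolynomial ℕ ℂ) ∣ P Q := fun Q => by
      simpa using X_sub_dvd_of_substHom_eq_zero (hall Q)
    obtain ⟨r, -, hr⟩ := MvPolynomial.isUnit_iff_eq_C_of_isReduced.1 (h.prim (X 1) hdvd)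
    have := congrArg (degreeOf 1) hr
    rw [degreeOf_C, degreeOf_X, if_pos rfl] at this
    exact one_ne_zero this
  have hP₁ : P Q₁ ≠ 0 := fun h0 => hQ₁ (by rw [h0, map_zero])
  -- its `z_1`-degree is `D_z = -2a`
  have ha0 : a ≤ 0 := by
    have := twist_nonpos hP₁ (h.bot Q₁); omega
  set D := (2 * (-a)).toNat with hD
  have hbotpow : genInv ℂ 1 (toRF ℂ (P Q₁)) * genZ ℂ 1 ^ D = toRF ℂ (P Q₁) := by
    rw [h.bot Q₁, mul_assoc, mul_comm (toRF ℂ (P Q₁)), ← mul_assoc, ← zpow_natCast, ← zpow_add₀ (genZ_ne_zero 1),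
      hD, Int.toNat_of_nonneg (by omega)]
    have : (2 * a + 2 * -a : ℤ) = 0 := by ring
    rw [this, zpow_zero, one_mul]
  have hdeg₁ : (P Q₁).degreeOf 1 ≤ D := degreeOf_le_of_genInv_mul_pow hbotpow
  have htopcoef : uCoeff ℂ 1 D (P Q₁) ≠ 0 := by
    rw [uCoeff_top_eq_substHom_of_revPoly hdeg₁ (revPoly_eq_self_of_genInv hdeg₁ hbotpow)]; exact hQ₁
  have hDle : D ≤ (P Q₁).degreeOf 1 := by
    by_contra hlt; rw [not_le] at hlt; exact htopcoef (uCoeff_eq_zero_of_lt hlt)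
  -- `deg_1 P ≤ deg_1 (C₀ P) = deg_1 Φ ≤ 4m`
  have hdegP : (P Q₁).degreeOf 1 ≤ (Φ Q₁).degreeOf 1 := by
    rw [hΦP Q₁, degreeOf_eq_natDegree_rapUni 1 (P Q₁), degreeOf_eq_natDegree_rapUni 1 (C₀ * P Q₁), map_mul,
      Polynomial.natDegree_mul ((map_ne_zero_iff _ (rapUni_injective 1)).2 hC₀0) ((map_ne_zero_iff _ (rapUni_injective 1)).2 hP₁)]
    exact Nat.le_add_left _ _
  have : D ≤ 4 * m := hDle.trans (hdegP.trans (hdegΦ Q₁))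
  rw [hD] at this
  omega

variable {n : ℕ} {P' : ColPattern (n + 1) → MvPolynomial ℕ ℂ}

/-- **`GroundStateBounds` from the polynomial qKZ solution**: the pair bound (relative pair bound +
pinned twist), `w`-freeness and the vanishing at `z_1 = 0`. [cite: IkhlefPonsaing2012, §3.4–4.1] -/
theorem bounds (hq : q ^ 2 + q + 1 = 0) (h : IsGroundState (n + 1) q P' a) {Φ : ColPattern (n + 1) → MvPolynomial ℕ ℂ}
    (hΦ : IsMinimalQKZSolution (n + 1) q Φ) : GroundStateBounds (n + 1) P' := by
  classical
  have ha := h.neg_twist_le hq hΦ.ne_zero hΦ.supp hΦ.odd hΦ.even hΦ.top hΦ.bot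
  refine ⟨fun s hs => ?_, h.wfree hq, fun Q Q' hJ => h.vanish hq (Nat.succ_ne_zero n) Q Q' hJ⟩
  obtain ⟨Q, -, hsQ⟩ := Finset.mem_biUnion.1 (support_sum hs)
  have hrel := h.pair_rel hq Q hsQ
  have : (2 * (-a)).toNat ≤ 4 * (n + 1) := by omega
  omega

end IsGroundState

/-- There is a primitive cube root of unity. [folklore] -/
theorem exists_quad_root : ∃ q : ℂ, q ^ 2 + q + 1 = 0 := by
  obtain ⟨w, hw⟩ := IsAlgClosed.exists_pow_nat_eq (-3 : ℂ) two_pos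
  exact ⟨(-1 + w) / 2, by linear_combination hw / 4⟩

/-- **IP12 Prop. 4.7 from the existence of the minimal polynomial qKZ solution** (at one primitive
cube root of unity `q`, for every width `≥ 1`). [cite: IkhlefPonsaing2012, Prop. 4.7] -/
theorem ikhlefPonsaingFirstPassage_of_polynomialSolution {q : ℂ} (hq : q ^ 2 + q + 1 = 0)
    (hE : ∀ k : ℕ, ∃ Φ : ColPattern (k + 1) → MvPolynomial ℕ ℂ, IsMinimalQKZSolution (k + 1) q Φ) :
    IkhlefPonsaingFirstPassage :=
  ikhlefPonsaingFirstPassage_of_bounds hq fun k P a h => by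
    obtain ⟨Φ, hΦ⟩ := hE k
    exact h.bounds hq hΦ

end Assembly

end Literature.Probability.Percolation
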